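import Literature.AlgebraicGeometry.Frobenioids.PerfectionFrobPow
import Mathlib.Tactic.Ring
import HarnessLib

/-!
# Frobenioids I, Definition 3.1 (ii)/(iii): the perfection `C^pf` — objects, levels, perfected morphisms

Mochizuki, *The geometry of Frobenioids I: the general theory*, Kyushu J. Math. **62** (2008)
293–400, Definition 3.1 (ii) (p. 56) and (iii) (p. 57) [cite: MochizukiFrdI2008, Def. 3.1 (iii) p.57].
Standing data: a Frobenioid `F : C ⥤ ElemFrobenioid Φ`, `hF : IsFrobenioid F`.

DISCLOSURE (hypothesis dropped, a proved generalisation).  Print constructs `C^pf` under the STANDING HYPOTHESIS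
"Suppose that the Frobenioid `C` is of Frobenius-isotropic type" (Def. 3.1 (iii) p. 56, restated in the
preamble of Prop. 3.2, p. 58); this chain (`PerfectionFrobPow`, `Perfection`, `PerfectionCategory`,
`PerfectionOps`, `PerfectionProofs`, `PerfectionCoAngular`) works over a bare Frobenioid `hF : IsFrobenioid F`
— the construction and Prop. 3.2 (i)(ii) need nothing more, so the printed instances follow a fortiori; the
hypothesis is used (and assumed) only where print needs it, for the isotropic-type clause of Prop. 3.2 (iii)
(`PerfectionIsotropic.lean`).

Printed definition. "The objects of `C^pf` are pairs `(A, n)`, where `A ∈ Ob(C)`, `n ∈ N_{≥1}`. The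
morphisms of `C^pf` are given by `Hom_{C^pf}((A, n), (B, m)) := Hom^pf_C(A′, B′)` where `A → A′` is a
morphism of Frobenius type of Frobenius degree `m`; `B → B′` is a morphism of Frobenius type of
Frobenius degree `n`"; and (ii) "`Hom^pf_C(A, B) := lim_→ Hom_C(A′, B′)`", the inductive limit over
pairs `(A → A′, B → B′)` of morphisms of Frobenius type of the same degree, with transition maps the
assignment "`φ ↦ φ′`" of Prop. 1.10 (i); "[Thus, in words, the pair `(A, n)` is to be thought of as an
'`n`-th root' of `A`.]"

Rendering (recorded for the referee; see also `PerfectionFrobPow.lean`). With the CHOSEN Frobenius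
powers `A^{(d)} = frobPow hF A d`, a *level* for `((A, n), (B, m))` is a pair `(a, b)` of positive
integers with `n·a = m·b`, and a representative of a morphism `(A, n) → (B, m)` at level `(a, b)` is an
arrow `A^{(a)} → B^{(b)}` of `C`; the transition to a higher level `(a′, b′)` (`a ∣ a′`, `b ∣ b′`) is the
Prop. 1.10 (i) conjugate along the transition morphisms `A^{(a)} → A^{(a′)}`, `B^{(b)} → B^{(b′)}` (which
have the same Frobenius degree `a′/a = b′/b`).  The levels form a directed preorder and the printed
`Hom^pf_C(A^{(m)}, B^{(n)})` is the inductive limit along the cofinal family of levels `(m·t, n·t)`; we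
take the inductive limit over ALL levels (same colimit, by cofinality), realised as the quotient
`Perfection.Hom X Y` of the representatives by "equal after transport to a common level".  This file:
objects, levels, transport, the setoid of representatives and the hom-sets; composition (at a common
triple level, "in the evident fashion") and the category structure are in `PerfectionCategory.lean`.
-/

namespace Literature.AlgebraicGeometry.Frobenioids

namespace PreFrobenioid

open CategoryTheory Opposite

universe w v v' u u'

variable {D : Type u} [Category.{v} D] {Φ : Dᵒᵖ ⥤ CommMonCat.{w}}
  {C : Type u'} [Category.{v'} C] {F : C ⥤ ElemFrobenioid Φ}

/-- The objects of the perfection `C^pf`: "pairs `(A, n)`, where `A ∈ Ob(C)`, `n ∈ N_{≥1}`" (the pair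
`(A, n)` "is to be thought of as an '`n`-th root' of `A`"). [cite: MochizukiFrdI2008, Def. 3.1 (iii) p.57] -/
@[ext] structure Perfection (hF : IsFrobenioid F) : Type u' where
  /-- the object `A` of `C` -/
  obj : C
  /-- the root index `n` -/
  idx : ℕ+

namespace Perfection

variable {hF : IsFrobenioid F}

/-- `Perfection.Obj hF` — alias for the type of objects `(A, n)` of `C^pf`.
[cite: MochizukiFrdI2008, Def. 3.1 (iii) p.57] -/
abbrev Obj (hF : IsFrobenioid F) : Type u' := Perfection hF

/-! ### Levels -/

/-- A *level* for morphisms `(A, n) → (B, m)`: positive integers `(a, b)` with `n·a = m·b`; the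
representatives at this level are the arrows `A^{(a)} → B^{(b)}` of `C`. [cite: MochizukiFrdI2008, Def. 3.1 (iii) p.57] -/
@[ext] structure Level (X Y : Perfection hF) where
  /-- the exponent at the source -/
  a : ℕ+
  /-- the exponent at the target -/
  b : ℕ+
  /-- the level condition `n·a = m·b` -/
  eq : X.idx * a = Y.idx * b

namespace Level

variable {X Y : Perfection hF}

/-- The divisibility order on levels. [cite: MochizukiFrdI2008, Def. 3.1 (ii) p.56] -/
def LE (L L' : Level X Y) : Prop := L.a ∣ L'.a ∧ L.b ∣ L'.b

/-- Reflexivity of the order on levels. [cite: MochizukiFrdI2008, Def. 3.1 (ii) p.56] -/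
theorem le_rfl (L : Level X Y) : L.LE L := ⟨dvd_rfl, dvd_rfl⟩

/-- Transitivity of the order on levels. [cite: MochizukiFrdI2008, Def. 3.1 (ii) p.56] -/
theorem LE.trans {L L' L'' : Level X Y} (h : L.LE L') (h' : L'.LE L'') : L.LE L'' :=
  ⟨h.1.trans h'.1, h.2.trans h'.2⟩

/-- Cross-multiplication of two levels: `b₁·a₂ = a₁·b₂`. [cite: MochizukiFrdI2008, Def. 3.1 (iii) p.57] -/
theorem b_mul_a (L₁ L₂ : Level X Y) : L₁.b * L₂.a = L₁.a * L₂.b := by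
  apply mul_left_cancel (a := Y.idx)
  calc Y.idx * (L₁.b * L₂.a) = X.idx * L₁.a * L₂.a := by rw [← mul_assoc, L₁.eq]
    _ = L₁.a * (X.idx * L₂.a) := by rw [mul_comm X.idx, mul_assoc]
    _ = Y.idx * (L₁.a * L₂.b) := by rw [L₂.eq, mul_left_comm]

/-- A common upper level of two levels (the index category is directed).
[cite: MochizukiFrdI2008, Def. 3.1 (ii) p.56] -/
abbrev sup (L₁ L₂ : Level X Y) : Level X Y :=
  ⟨L₁.a * L₂.a, L₁.b * L₂.a, by rw [← mul_assoc, L₁.eq, mul_assoc]⟩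

/-- `L₁ ≤ L₁ ⊔ L₂`. [cite: MochizukiFrdI2008, Def. 3.1 (ii) p.56] -/
theorem le_sup_left (L₁ L₂ : Level X Y) : L₁.LE (L₁.sup L₂) := ⟨dvd_mul_right _ _, dvd_mul_right _ _⟩

/-- `L₂ ≤ L₁ ⊔ L₂`. [cite: MochizukiFrdI2008, Def. 3.1 (ii) p.56] -/
theorem le_sup_right (L₁ L₂ : Level X Y) : L₂.LE (L₁.sup L₂) :=
  ⟨dvd_mul_left _ _, ⟨L₁.a, (b_mul_a L₁ L₂).trans (mul_comm _ _)⟩⟩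

/-- The transition morphisms at the two ends of `L ≤ L'` have the same Frobenius degree.
[cite: MochizukiFrdI2008, Def. 3.1 (iii) p.57] -/
theorem degFr_eq (L L' : Level X Y) (h : L.LE L') :
    degFr F (frobTrans hF X.obj h.1) = degFr F (frobTrans hF Y.obj h.2) :=
  degFr_frobTrans_eq hF X.obj Y.obj L.eq L'.eq h.1 h.2

/-- The representatives at level `(a, b)`: arrows `A^{(a)} → B^{(b)}` of `C`.
[cite: MochizukiFrdI2008, Def. 3.1 (ii) p.56] -/
abbrev HomAt (L : Level X Y) : Type v' := frobPow hF X.obj L.a ⟶ frobPow hF Y.obj L.b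

/-- Transport of representatives along `L ≤ L'` (the transition map "`φ ↦ φ′`" of the inductive system,
Prop. 1.10 (i)). [cite: MochizukiFrdI2008, Def. 3.1 (ii) p.56] -/
noncomputable def lift (L L' : Level X Y) (h : L.LE L') (φ : L.HomAt) : L'.HomAt :=
  liftLevel hF φ h.1 h.2 (degFr_eq L L' h)

/-- The defining square of the transport. [cite: MochizukiFrdI2008, Def. 3.1 (ii) p.56] -/
theorem lift_spec (L L' : Level X Y) (h : L.LE L') (φ : L.HomAt) :
    frobTrans hF X.obj h.1 ≫ lift L L' h φ = φ ≫ frobTrans hF Y.obj h.2 :=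
  liftLevel_spec hF φ h.1 h.2 _

/-- Uniqueness of the transport. [cite: MochizukiFrdI2008, Def. 3.1 (ii) p.56] -/
theorem lift_unique (L L' : Level X Y) (h : L.LE L') {φ : L.HomAt} {ψ : L'.HomAt}
    (hψ : frobTrans hF X.obj h.1 ≫ ψ = φ ≫ frobTrans hF Y.obj h.2) : ψ = lift L L' h φ :=
  liftLevel_unique hF h.1 h.2 _ hψ

/-- Transport to the same level is the identity. [cite: MochizukiFrdI2008, Def. 3.1 (ii) p.56] -/
@[simp] theorem lift_rfl (L : Level X Y) (h : L.LE L) (φ : L.HomAt) : lift L L h φ = φ :=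
  liftLevel_rfl hF φ h.1 h.2 _

/-- Transport is functorial in the level. [cite: MochizukiFrdI2008, Def. 3.1 (ii) p.56] -/
theorem lift_trans {L L' L'' : Level X Y} (h : L.LE L') (h' : L'.LE L'') (φ : L.HomAt) :
    lift L' L'' h' (lift L L' h φ) = lift L L'' (h.trans h') φ :=
  liftLevel_trans hF φ h.1 h.2 _ h'.1 h'.2 _ _

end Level

/-! ### Representatives and the hom-sets `Hom^pf` -/

/-- A representative of a perfected morphism `X → Y`: a level together with an arrow of `C` at that
level. [cite: MochizukiFrdI2008, Def. 3.1 (ii) p.56] -/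
structure Rep (X Y : Perfection hF) where
  /-- the level `(a, b)` -/
  L : Level X Y
  /-- the arrow `A^{(a)} → B^{(b)}` -/
  hom : L.HomAt

variable {X Y Z : Perfection hF}

/-- Two representatives define the same perfected morphism iff they agree after transport to some common
level (the equivalence relation of a directed inductive limit of sets). [cite: MochizukiFrdI2008, Def. 3.1 (ii) p.56] -/
def Agree (r s : Rep X Y) : Prop :=
  ∃ (M : Level X Y) (hr : r.L.LE M) (hs : s.L.LE M), Level.lift r.L M hr r.hom = Level.lift s.L M hs s.hom

/-- Agreement at a level persists at every higher level. [cite: MochizukiFrdI2008, Def. 3.1 (ii) p.56] -/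
theorem lift_eq_lift_of_le {r s : Rep X Y} {M : Level X Y} (hr : r.L.LE M) (hs : s.L.LE M)
    (h : Level.lift r.L M hr r.hom = Level.lift s.L M hs s.hom) {M' : Level X Y} (hM : M.LE M')
    (hr' : r.L.LE M') (hs' : s.L.LE M') :
    Level.lift r.L M' hr' r.hom = Level.lift s.L M' hs' s.hom := by
  rw [← Level.lift_trans hr hM, ← Level.lift_trans hs hM, h]

/-- `Agree` is reflexive. [cite: MochizukiFrdI2008, Def. 3.1 (ii) p.56] -/
theorem Agree.refl (r : Rep X Y) : Agree r r := ⟨r.L, r.L.le_rfl, r.L.le_rfl, rfl⟩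

/-- `Agree` is symmetric. [cite: MochizukiFrdI2008, Def. 3.1 (ii) p.56] -/
theorem Agree.symm {r s : Rep X Y} (h : Agree r s) : Agree s r := by
  obtain ⟨M, hr, hs, e⟩ := h
  exact ⟨M, hs, hr, e.symm⟩

/-- `Agree` is transitive (directedness of the levels). [cite: MochizukiFrdI2008, Def. 3.1 (ii) p.56] -/
theorem Agree.trans {r s t : Rep X Y} (h₁ : Agree r s) (h₂ : Agree s t) : Agree r t := by
  obtain ⟨M₁, hr, hs, e₁⟩ := h₁
  obtain ⟨M₂, hs', ht, e₂⟩ := h₂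
  refine ⟨M₁.sup M₂, hr.trans (Level.le_sup_left _ _), ht.trans (Level.le_sup_right _ _), ?_⟩
  rw [lift_eq_lift_of_le hr hs e₁ (Level.le_sup_left M₁ M₂) _ (hs.trans (Level.le_sup_left _ _)),
    lift_eq_lift_of_le hs' ht e₂ (Level.le_sup_right M₁ M₂) (hs.trans (Level.le_sup_left _ _)) _]

variable (X Y) in
/-- The setoid of representatives. [cite: MochizukiFrdI2008, Def. 3.1 (ii) p.56] -/
instance instSetoidRep : Setoid (Rep X Y) :=
  ⟨Agree, ⟨Agree.refl, Agree.symm, Agree.trans⟩⟩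

variable (X Y) in
/-- `Hom_{C^pf}(X, Y)` = the perfected morphisms: representatives modulo agreement after transport (the
inductive limit `lim_→ Hom_C(A″, B″)` of Def. 3.1 (ii)). [cite: MochizukiFrdI2008, Def. 3.1 (ii) p.56] -/
def Hom : Type v' := Quotient (instSetoidRep X Y)

/-- The class of a representative. [cite: MochizukiFrdI2008, Def. 3.1 (ii) p.56] -/
def Hom.mk (r : Rep X Y) : Hom X Y := Quotient.mk _ r

/-- Every perfected morphism has a representative. [cite: MochizukiFrdI2008, Def. 3.1 (ii) p.56] -/
theorem Hom.mk_surjective : Function.Surjective (Hom.mk : Rep X Y → Hom X Y) := Quotient.mk_surjective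

/-- Two representatives have the same class iff they agree at a common level.
[cite: MochizukiFrdI2008, Def. 3.1 (ii) p.56] -/
theorem Hom.mk_eq_mk {r s : Rep X Y} : Hom.mk r = Hom.mk s ↔ Agree r s := Quotient.eq (r := _)

/-- A representative is equivalent to its transport. [cite: MochizukiFrdI2008, Def. 3.1 (ii) p.56] -/
theorem Hom.mk_lift (r : Rep X Y) (M : Level X Y) (h : r.L.LE M) :
    Hom.mk ⟨M, Level.lift r.L M h r.hom⟩ = Hom.mk r :=
  Hom.mk_eq_mk.mpr ⟨M, M.le_rfl, h, by rw [Level.lift_rfl]⟩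

/-! ### Triple levels and the composite of representatives -/

variable (X Y Z) in
/-- A *triple level* `(a, b, c)` for a composable pair `X → Y → Z`: `n·a = m·b = k·c`.
[cite: MochizukiFrdI2008, Def. 3.1 (iii) p.57] -/
@[ext] structure Level₃ where
  /-- exponent at `X` -/
  a : ℕ+
  /-- exponent at `Y` -/
  b : ℕ+
  /-- exponent at `Z` -/
  c : ℕ+
  /-- `n·a = m·b` -/
  eq₁ : X.idx * a = Y.idx * b
  /-- `m·b = k·c` -/
  eq₂ : Y.idx * b = Z.idx * c

namespace Level₃

/-- The level `(a, b)` of a triple level. [cite: MochizukiFrdI2008, Def. 3.1 (iii) p.57] -/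
abbrev fst (T : Level₃ X Y Z) : Level X Y := ⟨T.a, T.b, T.eq₁⟩

/-- The level `(b, c)` of a triple level. [cite: MochizukiFrdI2008, Def. 3.1 (iii) p.57] -/
abbrev snd (T : Level₃ X Y Z) : Level Y Z := ⟨T.b, T.c, T.eq₂⟩

/-- The level `(a, c)` of a triple level. [cite: MochizukiFrdI2008, Def. 3.1 (iii) p.57] -/
abbrev out (T : Level₃ X Y Z) : Level X Z := ⟨T.a, T.c, T.eq₁.trans T.eq₂⟩

/-- The divisibility order on triple levels. [cite: MochizukiFrdI2008, Def. 3.1 (iii) p.57] -/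
def LE (T T' : Level₃ X Y Z) : Prop := T.a ∣ T'.a ∧ T.b ∣ T'.b ∧ T.c ∣ T'.c

/-- Components of the order. [cite: MochizukiFrdI2008, Def. 3.1 (iii) p.57] -/
theorem LE.fst {T T' : Level₃ X Y Z} (h : T.LE T') : T.fst.LE T'.fst := ⟨h.1, h.2.1⟩

/-- Components of the order. [cite: MochizukiFrdI2008, Def. 3.1 (iii) p.57] -/
theorem LE.snd {T T' : Level₃ X Y Z} (h : T.LE T') : T.snd.LE T'.snd := ⟨h.2.1, h.2.2⟩

/-- Components of the order. [cite: MochizukiFrdI2008, Def. 3.1 (iii) p.57] -/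
theorem LE.out {T T' : Level₃ X Y Z} (h : T.LE T') : T.out.LE T'.out := ⟨h.1, h.2.2⟩

/-- A common upper triple level. [cite: MochizukiFrdI2008, Def. 3.1 (iii) p.57] -/
abbrev sup (T₁ T₂ : Level₃ X Y Z) : Level₃ X Y Z :=
  ⟨T₁.a * T₂.a, T₁.b * T₂.a, T₁.c * T₂.a, by rw [← mul_assoc, T₁.eq₁, mul_assoc],
    by rw [← mul_assoc, T₁.eq₂, mul_assoc]⟩

/-- `T₁ ≤ T₁ ⊔ T₂`. [cite: MochizukiFrdI2008, Def. 3.1 (iii) p.57] -/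
theorem le_sup_left (T₁ T₂ : Level₃ X Y Z) : T₁.LE (T₁.sup T₂) :=
  ⟨dvd_mul_right _ _, dvd_mul_right _ _, dvd_mul_right _ _⟩

/-- `T₂ ≤ T₁ ⊔ T₂`. [cite: MochizukiFrdI2008, Def. 3.1 (iii) p.57] -/
theorem le_sup_right (T₁ T₂ : Level₃ X Y Z) : T₂.LE (T₁.sup T₂) :=
  ⟨dvd_mul_left _ _,
    ⟨T₁.a, (Level.b_mul_a T₁.fst T₂.fst).trans (mul_comm _ _)⟩,
    ⟨T₁.a, (Level.b_mul_a T₁.out T₂.out).trans (mul_comm _ _)⟩⟩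

/-- A triple level whose `(a, b)`-part dominates a given level of `X → Y`.
[cite: MochizukiFrdI2008, Def. 3.1 (iii) p.57] -/
abbrev ofFst (L : Level X Y) : Level₃ X Y Z :=
  ⟨L.a * Z.idx, L.b * Z.idx, L.b * Y.idx, by rw [← mul_assoc, L.eq, mul_assoc],
    by apply PNat.eq; simp only [PNat.mul_coe]; ring⟩

/-- `L ≤ (ofFst L).fst`. [cite: MochizukiFrdI2008, Def. 3.1 (iii) p.57] -/
theorem le_ofFst (L : Level X Y) : L.LE (ofFst (Z := Z) L).fst := ⟨dvd_mul_right _ _, dvd_mul_right _ _⟩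

/-- A triple level whose `(b, c)`-part dominates a given level of `Y → Z`.
[cite: MochizukiFrdI2008, Def. 3.1 (iii) p.57] -/
abbrev ofSnd (M : Level Y Z) : Level₃ X Y Z :=
  ⟨M.a * Y.idx, M.a * X.idx, M.b * X.idx, by apply PNat.eq; simp only [PNat.mul_coe]; ring,
    by rw [mul_comm M.a X.idx, ← mul_assoc, mul_comm Y.idx, mul_assoc, M.eq, ← mul_assoc,
      mul_comm X.idx, mul_assoc, mul_comm X.idx]⟩

/-- `M ≤ (ofSnd M).snd`. [cite: MochizukiFrdI2008, Def. 3.1 (iii) p.57] -/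
theorem le_ofSnd (M : Level Y Z) : M.LE (ofSnd (X := X) M).snd := ⟨dvd_mul_right _ _, dvd_mul_right _ _⟩

/-- The canonical triple level dominating the levels of two composable representatives.
[cite: MochizukiFrdI2008, Def. 3.1 (iii) p.57] -/
abbrev can (r : Rep X Y) (s : Rep Y Z) : Level₃ X Y Z :=
  ⟨r.L.a * s.L.a, r.L.b * s.L.a, s.L.b * r.L.b, by rw [← mul_assoc, r.L.eq, mul_assoc],
    by rw [mul_comm r.L.b, ← mul_assoc, s.L.eq, mul_assoc]⟩

/-- `r.L ≤ (can r s).fst`. [cite: MochizukiFrdI2008, Def. 3.1 (iii) p.57] -/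
theorem le_can_fst (r : Rep X Y) (s : Rep Y Z) : r.L.LE (can r s).fst :=
  ⟨dvd_mul_right _ _, dvd_mul_right _ _⟩

/-- `s.L ≤ (can r s).snd`. [cite: MochizukiFrdI2008, Def. 3.1 (iii) p.57] -/
theorem le_can_snd (r : Rep X Y) (s : Rep Y Z) : s.L.LE (can r s).snd :=
  ⟨dvd_mul_left _ _, dvd_mul_right _ _⟩

end Level₃

/-- The composite of two representatives at a common triple level: transport both and compose in `C`
("composition of morphisms of `C^pf` is defined in the evident fashion"). [cite: MochizukiFrdI2008, Def. 3.1 (iii) p.57] -/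
noncomputable def compAt (T : Level₃ X Y Z) (r : Rep X Y) (s : Rep Y Z) (hr : r.L.LE T.fst)
    (hs : s.L.LE T.snd) : T.out.HomAt :=
  Level.lift r.L T.fst hr r.hom ≫ Level.lift s.L T.snd hs s.hom

/-- The composite is compatible with transport to a higher triple level.
[cite: MochizukiFrdI2008, Def. 3.1 (iii) p.57] -/
theorem lift_compAt {T T' : Level₃ X Y Z} (h : T.LE T') (r : Rep X Y) (s : Rep Y Z)
    (hr : r.L.LE T.fst) (hs : s.L.LE T.snd) :
    Level.lift T.out T'.out h.out (compAt T r s hr hs) =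
      compAt T' r s (hr.trans h.fst) (hs.trans h.snd) := by
  have e₁ : Level.lift r.L T'.fst (hr.trans h.fst) r.hom =
      Level.lift T.fst T'.fst h.fst (Level.lift r.L T.fst hr r.hom) := (Level.lift_trans hr h.fst r.hom).symm
  have e₂ : Level.lift s.L T'.snd (hs.trans h.snd) s.hom =
      Level.lift T.snd T'.snd h.snd (Level.lift s.L T.snd hs s.hom) := (Level.lift_trans hs h.snd s.hom).symm
  unfold compAt
  rw [e₁, e₂]
  exact liftLevel_comp hF (Level.lift r.L T.fst hr r.hom) (Level.lift s.L T.snd hs s.hom) h.1 h.2.1 h.2.2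
    (Level.degFr_eq T.fst T'.fst h.fst) (Level.degFr_eq T.snd T'.snd h.snd)

end Perfection

end PreFrobenioid

end Literature.AlgebraicGeometry.Frobenioids
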